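import Literature.AlgebraicGeometry.Resolution.StrictTransformFiniteCentre
import Literature.RingTheory.FittingIdeal.ConstantRank
import Literature.RingTheory.FittingIdeal.BaseChange
import Mathlib.AlgebraicGeometry.Morphisms.Flat
import HarnessLib

/-!
# The rank stratification of a finite morphism by Fitting ideal sheaves

Topic: `Literature/AlgebraicGeometry/Resolution`. For a finite morphism `f : X → S` the opens
`S_r = (S ∖ V(Fit_r(f_*𝒪_X))) ∩ ⋂_{k<r} {Fit_k(f_*𝒪_X) = 0}` ("`X` is locally free of rank
exactly `r`", Stacks 07ZD / 05P8) are pairwise disjoint; on affine opens inside `S_r` the Fitting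
sheaves satisfy `Fit_r = 𝒪`, `Fit_k = 0` (`k < r`) — the hypothesis of
`exists_isBlowup_flat_lfp_of_isFinite_of_fittingRank` (`StrictTransformFiniteCentre.lean`); and
over an open `U` on which `f` is flat and of finite presentation they cover `U`: the rank of the
finite locally free `𝒪_U`-module `f_*𝒪_X|_U` is locally constant (Stacks 00NX) and determines the
Fitting ideals (Stacks 07ZD). This is the step "`U = U_0 ⨿ U_1 ⨿ … ⨿ U_c`" in the proof of
Stacks 0811 / 081R for finite morphisms.

* `Scheme.Hom.rankStratum f r` — the open `S_r`;
* `fittingRank_of_le_rankStratum` — the Fitting conditions on affine opens inside `S_r`;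
* `rankStratum_inf_rankStratum_eq_bot` — disjointness;
* `flat_app_of_flat_morphismRestrict` — ring-level flatness over affine opens of `U` from
  `Flat (f ∣_ U)`;
* `le_iSup_rankStratum_of_flat` — **the strata cover `U` when `f|_U` is flat** (`f` finite,
  locally of finite presentation).

## References

* The Stacks Project, Tag 0811 (proof), Tag 07ZD, Tag 00NX. [StacksProject]
-/

noncomputable section

open CategoryTheory CategoryTheory.Limits AlgebraicGeometry TopologicalSpace

namespace Literature.AlgebraicGeometry.Resolution

universe u

open Literature.RingTheory.FittingIdeal Literature.AlgebraicGeometry.Limits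
  Literature.AlgebraicGeometry.Morphisms TensorProduct

/-! ## The strata -/

/-- **The rank-`r` stratum** of a finite morphism `f : X → S`: the open of `S` where
`Fit_r(f_*𝒪_X)` is the unit ideal and `Fit_k(f_*𝒪_X)` vanishes for all `k < r`
("`f_*𝒪_X` locally free of rank exactly `r`"). [cite: StacksProject, Tag 07ZD] -/
def _root_.AlgebraicGeometry.Scheme.Hom.rankStratum {X S : Scheme.{u}} (f : X.Hom S) [IsFinite f]
    (r : ℕ) : S.Opens :=
  centreCompl (f.fittingIdealSheaf r) ⊓ ⨅ k : Fin r, vanishingOpen (f.fittingIdealSheaf k)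

variable {X S : Scheme.{u}} (f : X ⟶ S) [IsFinite f]

/-- On an affine open inside the rank-`r` stratum, `Fit_r = 𝒪` and `Fit_k = 0` for `k < r`.
[cite: StacksProject, Tag 07ZD] -/
theorem fittingRank_of_le_rankStratum (r : ℕ) (W : S.affineOpens)
    (hW : (W : S.Opens) ≤ f.rankStratum r) :
    (f.fittingIdealSheaf r).ideal W = ⊤ ∧ ∀ k < r, (f.fittingIdealSheaf k).ideal W = ⊥ := by
  refine ⟨ideal_eq_top_of_le_centreCompl _ W (hW.trans inf_le_left), fun k hk => ?_⟩
  refine ideal_eq_bot_of_le_vanishingOpen _ W (hW.trans (inf_le_right.trans ?_))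
  exact iInf_le (fun k : Fin r => vanishingOpen (f.fittingIdealSheaf k)) ⟨k, hk⟩

/-- An affine open on which some ideal sheaf is both the unit ideal and zero is empty. [folklore] -/
theorem not_mem_of_ideal_eq_top_of_eq_bot {I : S.IdealSheafData} {W : S.affineOpens}
    (htop : I.ideal W = ⊤) (hbot : I.ideal W = ⊥) (p : S) : p ∉ (W : S.Opens) := fun hp => by
  have h10 : (1 : Γ(S, W)) = 0 := by
    rw [← Ideal.mem_bot, ← hbot, htop]
    trivial
  have : p ∈ S.basicOpen (1 : Γ(S, W)) := by
    rw [Scheme.basicOpen_one]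
    exact hp
  rw [h10, Scheme.basicOpen_zero] at this
  exact this

/-- **The strata are pairwise disjoint.** [cite: StacksProject, Tag 0811 (proof)] -/
theorem rankStratum_inf_rankStratum_eq_bot {r r' : ℕ} (h : r ≠ r') :
    f.rankStratum r ⊓ f.rankStratum r' = ⊥ := by
  wlog hlt : r < r' generalizing r r'
  · rw [inf_comm]
    exact this h.symm (lt_of_le_of_ne (not_lt.mp hlt) h.symm)
  rw [eq_bot_iff]
  rintro p ⟨hp, hp'⟩
  obtain ⟨W, hW, hpW, hWle⟩ := exists_isAffineOpen_mem_and_subset (X := S) (x := p)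
    (U := f.rankStratum r ⊓ f.rankStratum r') ⟨hp, hp'⟩
  have h1 := (fittingRank_of_le_rankStratum f r ⟨W, hW⟩ (fun x hx => (hWle hx).1)).1
  have h2 := (fittingRank_of_le_rankStratum f r' ⟨W, hW⟩ (fun x hx => (hWle hx).2)).2 r hlt
  exact not_mem_of_ideal_eq_top_of_eq_bot h1 h2 p hpW

/-! ## Flatness over affine opens of `U` -/

omit [IsFinite f] in
/-- For `f` affine with `f|_U` flat and an affine open `W ⊆ U`, the ring map
`Γ(S, W) → Γ(X, f⁻¹W)` is flat. [folklore] -/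
theorem flat_app_of_flat_morphismRestrict [IsAffineHom f] (U : S.Opens) [Flat (f ∣_ U)]
    (W : S.affineOpens) (hW : (W : S.Opens) ≤ U) : (f.app W).hom.Flat := by
  -- the affine opens `U.ι⁻¹ W` of `U` and `(f⁻¹U).ι⁻¹ (f⁻¹ W)` of `f⁻¹ U`
  let V : (U : Scheme.{u}).affineOpens := Limits.preimageAffineOpens U W hW
  let W' : ((f ⁻¹ᵁ U : X.Opens) : Scheme.{u}).affineOpens :=
    Limits.preimageAffineOpens (f ⁻¹ᵁ U) ⟨f ⁻¹ᵁ (W : S.Opens), W.2.preimage f⟩ (f.preimage_mono hW)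
  have e : (W' : ((f ⁻¹ᵁ U : X.Opens) : Scheme.{u}).Opens) ≤ (f ∣_ U) ⁻¹ᵁ (V : (U : Scheme.{u}).Opens) := by
    change (f ⁻¹ᵁ U).ι ⁻¹ᵁ (f ⁻¹ᵁ (W : S.Opens)) ≤ (f ∣_ U) ⁻¹ᵁ (U.ι ⁻¹ᵁ (W : S.Opens))
    rw [← Scheme.Hom.comp_preimage, ← Scheme.Hom.comp_preimage, morphismRestrict_ι]
  have h2 : (f.appLE (U.ι ''ᵁ (V : (U : Scheme.{u}).Opens))
      ((f ⁻¹ᵁ U).ι ''ᵁ (W' : ((f ⁻¹ᵁ U : X.Opens) : Scheme.{u}).Opens))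
      ((Set.image_mono e).trans (image_morphismRestrict_preimage f U V).le)).hom.Flat := by
    have h := HasRingHomProperty.appLE @Flat (f := f ∣_ U) inferInstance V W' e
    rw [morphismRestrict_appLE] at h
    exact h
  have hV : U.ι ''ᵁ (V : (U : Scheme.{u}).Opens) = W :=
    congrArg Subtype.val (Limits.imageAffineOpens_preimageAffineOpens U W hW)
  have hW' : (f ⁻¹ᵁ U).ι ''ᵁ (W' : ((f ⁻¹ᵁ U : X.Opens) : Scheme.{u}).Opens) = f ⁻¹ᵁ (W : S.Opens) :=
    congrArg Subtype.val (Limits.imageAffineOpens_preimageAffineOpens (f ⁻¹ᵁ U)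
      ⟨f ⁻¹ᵁ (W : S.Opens), W.2.preimage f⟩ (f.preimage_mono hW))
  have h3 := (Scheme.Hom.appLE_congr f _ hV hW' (fun g => g.hom.Flat)).mp h2
  rwa [← Scheme.Hom.app_eq_appLE] at h3

/-! ## The strata cover the flat locus -/

/-- **The rank strata cover `U` when `f|_U` is flat** (`f` finite and locally of finite
presentation): the rank of the finite locally free module `Γ(X, f⁻¹W)` (`W ⊆ U` affine) is
locally constant on `Spec Γ(S, W)` (Stacks 00NX), and on a basic open `D(g) ∋ p` where it is
constant, `= r`, the Fitting ideals are `Fit_r = 𝒪`, `Fit_k = 0` (`k < r`) (Stacks 07ZD), i.e.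
`D(g) ⊆ S_r`. [cite: StacksProject, Tag 0811 (proof)] -/
theorem le_iSup_rankStratum_of_flat [LocallyOfFinitePresentation f] (U : S.Opens) [Flat (f ∣_ U)] :
    U ≤ ⨆ r : ℕ, f.rankStratum r := by
  intro p hpU
  obtain ⟨W, hW, hpW, hWU⟩ := exists_isAffineOpen_mem_and_subset (X := S) (x := p) (U := U) hpU
  -- the finite flat finitely presented module `M = Γ(X, f⁻¹W)` over `A = Γ(S, W)`
  let Wa : S.affineOpens := ⟨W, hW⟩
  letI alg : Algebra Γ(S, Wa) Γ(X, f ⁻¹ᵁ (Wa : S.Opens)) := (f.app (Wa : S.Opens)).hom.toAlgebra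
  haveI : Module.Finite Γ(S, Wa) Γ(X, f ⁻¹ᵁ (Wa : S.Opens)) := finite_app_of_isFinite f Wa
  haveI : Algebra.FinitePresentation Γ(S, Wa) Γ(X, f ⁻¹ᵁ (Wa : S.Opens)) := by
    have h := f.finitePresentation_appLE Wa.2 (Wa.2.preimage f) le_rfl
    rw [← Scheme.Hom.app_eq_appLE] at h
    exact h
  haveI : Module.FinitePresentation Γ(S, Wa) Γ(X, f ⁻¹ᵁ (Wa : S.Opens)) :=
    Module.FinitePresentation.of_finite_of_finitePresentation _ _
  haveI : Module.Flat Γ(S, Wa) Γ(X, f ⁻¹ᵁ (Wa : S.Opens)) := flat_app_of_flat_morphismRestrict f U Wa hWU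
  -- the rank is locally constant: constant `= r` on a basic open `D(g) ∋ p`
  let P : PrimeSpectrum Γ(S, Wa) := hW.primeIdealOf ⟨p, hpW⟩
  set r := Module.rankAtStalk Γ(X, f ⁻¹ᵁ (Wa : S.Opens)) P with hr
  have hopen : IsOpen {q : PrimeSpectrum Γ(S, Wa) | Module.rankAtStalk Γ(X, f ⁻¹ᵁ (Wa : S.Opens)) q = r} :=
    Module.isLocallyConstant_rankAtStalk.isOpen_fiber r
  obtain ⟨_, ⟨g, rfl⟩, hPg, hgfib⟩ := PrimeSpectrum.isTopologicalBasis_basic_opens.exists_subset_of_mem_open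
    (show P ∈ _ from hr.symm ▸ rfl) hopen
  -- `p ∈ D(g) ⊆ W`
  have hpg : p ∈ S.basicOpen g := by
    rw [← hW.fromSpec_image_basicOpen g]
    exact ⟨P, hPg, hW.fromSpec_primeIdealOf ⟨p, hpW⟩⟩
  -- the base change `T ⊗ M` to `T = Γ(S, D(g)) = A[1/g]` has constant rank `r`
  let T := Γ(S, S.basicOpen g)
  haveI : IsLocalization.Away g T := hW.isLocalization_basicOpen g
  have hrank : ∀ q : PrimeSpectrum T,
      Module.rankAtStalk (T ⊗[Γ(S, Wa)] Γ(X, f ⁻¹ᵁ (Wa : S.Opens))) q = r := fun q => by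
    rw [Module.rankAtStalk_baseChange]
    apply hgfib
    show q.comap (algebraMap Γ(S, Wa) T) ∈ (PrimeSpectrum.basicOpen g : Set _)
    rw [← PrimeSpectrum.localization_away_comap_range T g]
    exact Set.mem_range_self q
  have hsheaf : ∀ k, (f.fittingIdealSheaf k).ideal (S.affineBasicOpen g) =
      Module.fittingIdeal T (T ⊗[Γ(S, Wa)] Γ(X, f ⁻¹ᵁ (Wa : S.Opens))) k := fun k => by
    rw [Module.fittingIdeal_baseChange, ← (f.fittingIdealSheaf k).map_ideal_basicOpen Wa g,
      fittingIdealSheaf_ideal]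
    rfl
  have htop : (f.fittingIdealSheaf r).ideal (S.affineBasicOpen g) = ⊤ := by
    rw [hsheaf]
    exact Module.fittingIdeal_eq_top_of_rankAtStalk_eq hrank
  have hbot : ∀ k < r, (f.fittingIdealSheaf k).ideal (S.affineBasicOpen g) = ⊥ := fun k hk => by
    rw [hsheaf]
    exact Module.fittingIdeal_eq_bot_of_lt_rankAtStalk fun q => (hrank q).symm ▸ hk
  -- hence `p ∈ S_r`
  refine Opens.mem_iSup.mpr ⟨r, ?_, ?_⟩
  · -- `p ∉ V(Fit_r)`
    intro hps
    rw [SetLike.mem_coe, Scheme.IdealSheafData.mem_support_iff_of_mem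
      (U := S.affineBasicOpen g) hpg, Scheme.mem_zeroLocus_iff] at hps
    exact hps 1 (htop ▸ Submodule.mem_top) (by rw [Scheme.basicOpen_one]; exact hpg)
  · exact (le_iInf fun k : Fin r => le_vanishingOpen (f.fittingIdealSheaf k) (hbot k k.2)) hpg

end Literature.AlgebraicGeometry.Resolution

end
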